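import Literature.NumberTheory.Sieve.FordMaynardSliceConvolution
import Literature.Analysis.Convolution.ModifiedLiouville
import Mathlib.Topology.MetricSpace.Lipschitz
import HarnessLib

/-!
# Ford–Maynard, Lemma 9.5: the functions `m^k λ̃^{(c,η)}` belong to `𝔉*_η(γ)`

Companion of `FordMaynardFramework.lean` (the class `𝔉*_η(γ)` = `MemTypeIStar`) and of the
one-dimensional model `Literature/Analysis/Convolution/ModifiedLiouville.lean` of Ford–Maynard's
modified Liouville function `M^{(c,η)}` (K. Ford, J. Maynard, *On the theory of prime producing
sieves*, arXiv:2407.14368, §9.1). Everything here is PROVED.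

* Closure of `𝔉*_η(γ)`: `MemTypeIStar.const_mul`, `MemTypeIStar.add` (for measurable summands;
  the Type-I terms are additive by `sliceIntegral_add`), `MemTypeIStar.mono` (`𝔉*_{η'} ⊆ 𝔉*_η`
  for `η ≤ η'`), with the auxiliary `IsPiecewiseLipschitz.add/const_mul/of_fintype` and
  `isConvexPolytope_of_constraints`.
* `FordMaynard.lamVec η c m` — the function of Lemma 9.5,
  `f(x₁,…,x_k) = m^k λ̃^{(c,η)}(x) = m^k ∏ M^{(c,η)}(x_i)` on vectors with all `x_i ≥ η` and
  `x₁ + ⋯ + x_k = 1` (zero elsewhere), with `M^{(c,η)} = modLiouville η c`.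
* `memTypeIStar_lamVec` — **Lemma 9.5**: for `0 < η`, `3η ≤ c ≤ 1`, `γ < 1` and `m c ≤ 1 − γ`,
  `lamVec η c m ∈ 𝔉*_η(γ)`. Symmetry and support are by construction; boundedness from the
  support (dimension `≤ 1/η`); piecewise Lipschitz on the `2^k` convex polytopes obtained by
  deciding which coordinates are `< c` (`M^{(c,η)} = −1` on `[η,c)`, Lipschitz on `[c,1]`); and the
  Type-I identity (TypeI-f) exactly as printed: the slice integral of the product
  `∏ M(u_i)/u_i = ∏ ℓ(u_i)` is the convolution power `ℓ^{⋆d}(w)` (`sliceIntegral_const_mul_prod`),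
  and `∑_d (m^d/d!) ℓ^{⋆d}(w) = 0` for `w = 1 − |ξ| ≥ 1 − γ ≥ m c` is the model Lemma 9.2
  (`sum_cpow_ellFn_eq_zero`).

The hypothesis `3η ≤ c ≤ 1` (in place of the printed `η < c`) comes from the window `[0, 3]` of
the model; it is harmless for §9.2, where `η` is taken small.

## References

* K. Ford, J. Maynard, *On the theory of prime producing sieves*, arXiv:2407.14368v1 (2024), §9.1,
  Lemma 9.2, Lemma 9.5 and its proof (`lit read arxiv:2407.14368`, chunks 51–53).
  [FordMaynard2024PrimeSieves]
-/

noncomputable section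

open MeasureTheory Finset Literature.Analysis.Convolution

namespace Literature.NumberTheory.Sieve.FordMaynard

/-! ### Piecewise Lipschitz functions: finite sums -/

section Piecewise

variable {k : ℕ}

/-- A piecewise Lipschitz presentation indexed by any finite type gives Definition 6.2 (b).
[cite: FordMaynard2024PrimeSieves, Definition 6.2 (b)] -/
theorem IsPiecewiseLipschitz.of_fintype {g : (Fin k → ℝ) → ℝ} {ι : Type*} [Fintype ι]
    (P : ι → Set (Fin k → ℝ)) (h : ι → (Fin k → ℝ) → ℝ)
    (hP : ∀ j, IsConvexPolytope (P j)) (h0 : ∀ j x, x ∉ P j → h j x = 0)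
    (hL : ∀ j, ∃ K, LipschitzOnWith K (h j) (P j)) (hg : ∀ x, g x = ∑ j, h j x) :
    IsPiecewiseLipschitz g := by
  classical
  refine ⟨Fintype.card ι, fun j => P ((Fintype.equivFin ι).symm j),
    fun j => h ((Fintype.equivFin ι).symm j), fun j => ⟨hP _, h0 _, hL _⟩, fun x => ?_⟩
  rw [hg x]
  exact (Equiv.sum_comp (Fintype.equivFin ι).symm (fun j => h j x)).symm

/-- Scalar multiples of piecewise Lipschitz functions are piecewise Lipschitz.
[cite: FordMaynard2024PrimeSieves, Definition 6.2 (b)] -/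
theorem IsPiecewiseLipschitz.const_mul {g : (Fin k → ℝ) → ℝ} (hg : IsPiecewiseLipschitz g)
    (a : ℝ) : IsPiecewiseLipschitz (fun x => a * g x) := by
  obtain ⟨m, P, h, hP, hsum⟩ := hg
  refine ⟨m, P, fun j x => a * h j x, fun j => ⟨(hP j).1, fun x hx => ?_, ?_⟩, fun x => ?_⟩
  · show a * h j x = 0
    rw [(hP j).2.1 x hx, mul_zero]
  · obtain ⟨K, hK⟩ := (hP j).2.2
    refine ⟨Real.toNNReal |a| * K, LipschitzOnWith.of_dist_le_mul fun x hx y hy => ?_⟩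
    have hxy := hK.dist_le_mul x hx y hy
    rw [Real.dist_eq] at hxy ⊢
    rw [← mul_sub, abs_mul, NNReal.coe_mul, Real.coe_toNNReal _ (abs_nonneg a), mul_assoc]
    exact mul_le_mul_of_nonneg_left hxy (abs_nonneg a)
  · show a * g x = ∑ j, a * h j x
    rw [hsum x, Finset.mul_sum]

/-- Sums of piecewise Lipschitz functions are piecewise Lipschitz (concatenate the families).
[cite: FordMaynard2024PrimeSieves, Definition 6.2 (b)] -/
theorem IsPiecewiseLipschitz.add {g g' : (Fin k → ℝ) → ℝ} (hg : IsPiecewiseLipschitz g)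
    (hg' : IsPiecewiseLipschitz g') : IsPiecewiseLipschitz (fun x => g x + g' x) := by
  obtain ⟨m, P, h, hP, hsum⟩ := hg
  obtain ⟨m', P', h', hP', hsum'⟩ := hg'
  refine IsPiecewiseLipschitz.of_fintype (ι := Fin m ⊕ Fin m') (Sum.elim P P') (Sum.elim h h')
    ?_ ?_ ?_ fun x => ?_
  · rintro (j | j)
    exacts [(hP j).1, (hP' j).1]
  · rintro (j | j)
    exacts [(hP j).2.1, (hP' j).2.1]
  · rintro (j | j)
    exacts [(hP j).2.2, (hP' j).2.2]
  · rw [Fintype.sum_sum_type, hsum x, hsum' x]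
    simp

/-- A bounded set cut out by finitely many strict and non-strict linear constraints, indexed by
finite types, is a convex polytope in the sense of Definition 5.7.
[cite: FordMaynard2024PrimeSieves, Definition 5.7] -/
theorem isConvexPolytope_of_constraints {ι₁ ι₂ : Type*} [Fintype ι₁] [Fintype ι₂]
    (a₁ : ι₁ → Fin k → ℝ) (b₁ : ι₁ → ℝ) (a₂ : ι₂ → Fin k → ℝ) (b₂ : ι₂ → ℝ)
    {P : Set (Fin k → ℝ)} (hB : Bornology.IsBounded P)
    (hP : ∀ x, x ∈ P ↔ (∀ j, ∑ i, a₁ j i * x i < b₁ j) ∧ ∀ j, ∑ i, a₂ j i * x i ≤ b₂ j) :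
    IsConvexPolytope P := by
  classical
  refine ⟨hB, Finset.univ.image fun j => (a₁ j, b₁ j), Finset.univ.image fun j => (a₂ j, b₂ j), ?_⟩
  ext x
  rw [hP x, Set.mem_setOf_eq]
  simp only [Finset.mem_image, Finset.mem_univ, true_and, forall_exists_index,
    forall_apply_eq_imp_iff]

end Piecewise

/-! ### Closure properties of `𝔉*_η(γ)` -/

section Closure

variable {η η' γ γ' : ℝ} {f g : VecFn}

/-- The Type-I terms are homogeneous in `f`. [cite: FordMaynard2024PrimeSieves, Definition 6.2 (c)] -/
theorem typeITerm_const_mul (f : VecFn) (a : ℝ) (r : ℕ) (ξ : Fin r → ℝ) (d : ℕ) :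
    typeITerm (fun k x => a * f k x) r ξ d = a * typeITerm f r ξ d := by
  unfold typeITerm
  have : (fun u : Fin d → ℝ => a * f (r + d) (Fin.append ξ u) / ∏ i, u i) =
      fun u => a * (f (r + d) (Fin.append ξ u) / ∏ i, u i) := by
    funext u; ring
  rw [this, sliceIntegral_const_mul]
  ring

/-- `u ↦ (ξ, u)` is measurable. [folklore] -/
theorem measurable_append {r d : ℕ} (ξ : Fin r → ℝ) :
    Measurable (fun u : Fin d → ℝ => Fin.append ξ u) := by
  refine measurable_pi_iff.2 fun i => ?_
  induction i using Fin.addCases with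
  | left j => simp only [Fin.append_left]; exact measurable_const
  | right j => simp only [Fin.append_right]; exact measurable_pi_apply j

/-- On a slice, the Type-I integrand `f(ξ, v)/(v₁⋯v_d)` of a function of `𝔉*_η(γ)` bounded by `F`
is bounded by `F/η^d` (it vanishes unless all `v_i ≥ η`). [cite: FordMaynard2024PrimeSieves, Definition 6.2] -/
theorem MemTypeIStar.abs_div_prod_le (hf : MemTypeIStar η γ f) (hη : 0 < η) {F : ℝ}
    (hF : ∀ k ξ, |f k ξ| ≤ F) {r d : ℕ} (ξ : Fin r → ℝ) (v : Fin d → ℝ) :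
    |f (r + d) (Fin.append ξ v) / ∏ i, v i| ≤ F / η ^ d := by
  have hF0 : 0 ≤ F := (abs_nonneg _).trans (hF 0 Fin.elim0)
  by_cases h : f (r + d) (Fin.append ξ v) = 0
  · rw [h, zero_div, abs_zero]; positivity
  · obtain ⟨hge, -⟩ := hf.support _ _ h
    have hv : ∀ i, η ≤ v i := fun i => by simpa using hge (Fin.natAdd r i)
    have hprod : η ^ d ≤ ∏ i, v i := by
      calc η ^ d = ∏ _i : Fin d, η := by simp
        _ ≤ ∏ i, v i := Finset.prod_le_prod (fun i _ => hη.le) fun i _ => hv i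
    have hpos : 0 < ∏ i, v i := lt_of_lt_of_le (pow_pos hη d) hprod
    rw [abs_div, abs_of_pos hpos, div_le_div_iff₀ hpos (pow_pos hη d)]
    exact mul_le_mul (hF _ _) hprod (pow_nonneg hη.le d) hF0

/-- **Additivity of the Type-I terms** for measurable functions of `𝔉*` classes (`η > 0`).
[cite: FordMaynard2024PrimeSieves, Definition 6.2 (c)] -/
theorem typeITerm_add (hη : 0 < η) (hf : MemTypeIStar η γ f) (hg : MemTypeIStar η γ' g)
    (hfm : ∀ k, Measurable (f k)) (hgm : ∀ k, Measurable (g k)) (r : ℕ) (ξ : Fin r → ℝ)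
    (d : ℕ) :
    typeITerm (fun k x => f k x + g k x) r ξ d = typeITerm f r ξ d + typeITerm g r ξ d := by
  unfold typeITerm
  cases d with
  | zero => simp [sliceIntegral]
  | succ d =>
    obtain ⟨F, hF⟩ := hf.bounded
    obtain ⟨G, hG⟩ := hg.bounded
    have hF0 : 0 ≤ F := (abs_nonneg _).trans (hF 0 Fin.elim0)
    have hG0 : 0 ≤ G := (abs_nonneg _).trans (hG 0 Fin.elim0)
    have hmeas : ∀ φ : VecFn, (∀ k, Measurable (φ k)) →
        Measurable fun u : Fin (d + 1) → ℝ => φ (r + (d + 1)) (Fin.append ξ u) / ∏ i, u i :=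
      fun φ hφ => ((hφ _).comp (measurable_append ξ)).div
        (Finset.measurable_prod _ fun i _ => measurable_pi_apply i)
    have key := sliceIntegral_add d (1 - ∑ i, ξ i) (hmeas f hfm) (hmeas g hgm)
      (C := max (F / η ^ (d + 1)) (G / η ^ (d + 1))) (le_max_of_le_left (by positivity))
      (fun v _ _ => (hf.abs_div_prod_le hη hF ξ v).trans (le_max_left _ _))
      (fun v _ _ => (hg.abs_div_prod_le hη hG ξ v).trans (le_max_right _ _))
    simp only [add_div]
    rw [key]
    ring

/-- `𝔉*_η(γ)` is closed under scalar multiplication. [cite: FordMaynard2024PrimeSieves, §9 (definition of 𝔉*_η(γ))] -/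
theorem MemTypeIStar.const_mul (hf : MemTypeIStar η γ f) (a : ℝ) :
    MemTypeIStar η γ (fun k x => a * f k x) where
  symm k σ ξ := by
    show a * f k (ξ ∘ σ) = a * f k ξ
    rw [hf.symm]
  support k ξ h := hf.support k ξ fun h0 => h (by show a * f k ξ = 0; rw [h0, mul_zero])
  bounded := by
    obtain ⟨F, hF⟩ := hf.bounded
    exact ⟨|a| * F, fun k ξ => by
      rw [abs_mul]; exact mul_le_mul_of_nonneg_left (hF k ξ) (abs_nonneg a)⟩
  piecewiseLipschitz k := (hf.piecewiseLipschitz k).const_mul a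
  typeI r ξ hξ := by
    obtain ⟨N₀, h₀⟩ := hf.typeI r ξ hξ
    refine ⟨N₀, fun N hN => ?_⟩
    simp_rw [typeITerm_const_mul]
    rw [← Finset.mul_sum, h₀ N hN, mul_zero]

/-- `𝔉*_η(γ)` (`η > 0`) is closed under addition of measurable members (the Type-I terms add up
by `sliceIntegral_add`). [cite: FordMaynard2024PrimeSieves, §9 (definition of 𝔉*_η(γ))] -/
theorem MemTypeIStar.add (hη : 0 < η) (hf : MemTypeIStar η γ f) (hg : MemTypeIStar η γ g)
    (hfm : ∀ k, Measurable (f k)) (hgm : ∀ k, Measurable (g k)) :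
    MemTypeIStar η γ (fun k x => f k x + g k x) where
  symm k σ ξ := by
    show f k (ξ ∘ σ) + g k (ξ ∘ σ) = f k ξ + g k ξ
    rw [hf.symm, hg.symm]
  support k ξ h := by
    by_cases h1 : f k ξ = 0
    · have h2 : g k ξ ≠ 0 := fun h2 => h (by show f k ξ + g k ξ = 0; rw [h1, h2, add_zero])
      exact hg.support k ξ h2
    · exact hf.support k ξ h1
  bounded := by
    obtain ⟨F, hF⟩ := hf.bounded
    obtain ⟨G, hG⟩ := hg.bounded
    exact ⟨F + G, fun k ξ => (abs_add_le _ _).trans (add_le_add (hF k ξ) (hG k ξ))⟩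
  piecewiseLipschitz k := (hf.piecewiseLipschitz k).add (hg.piecewiseLipschitz k)
  typeI r ξ hξ := by
    obtain ⟨N₁, h₁⟩ := hf.typeI r ξ hξ
    obtain ⟨N₂, h₂⟩ := hg.typeI r ξ hξ
    refine ⟨max N₁ N₂, fun N hN => ?_⟩
    simp_rw [typeITerm_add hη hf hg hfm hgm]
    rw [Finset.sum_add_distrib, h₁ N (le_of_max_le_left hN), h₂ N (le_of_max_le_right hN),
      add_zero]

/-- Monotonicity in `η`: `𝔉*_{η'}(γ) ⊆ 𝔉*_η(γ)` for `η ≤ η'`. [cite: FordMaynard2024PrimeSieves, §9.2] -/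
theorem MemTypeIStar.mono (hf : MemTypeIStar η' γ f) (h : η ≤ η') : MemTypeIStar η γ f where
  symm := hf.symm
  support k ξ hne := ⟨fun i => h.trans ((hf.support k ξ hne).1 i), (hf.support k ξ hne).2⟩
  bounded := hf.bounded
  piecewiseLipschitz := hf.piecewiseLipschitz
  typeI := hf.typeI

end Closure

/-! ### The functions `m^k λ̃^{(c,η)}` of Lemma 9.5 -/

section Lambda

variable {η c γ : ℝ} {m : ℕ}

open scoped Classical in
/-- **The function of Lemma 9.5**: `f(x₁, …, x_k) = m^k λ̃^{(c,η)}(x) = m^k ∏_i M^{(c,η)}(x_i)` for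
vectors with all `x_i ≥ η` and `x₁ + ⋯ + x_k = 1`, and `0` on all other vectors, with the
modified Liouville function `M^{(c,η)} = modLiouville η c` of the one-dimensional model.
[cite: FordMaynard2024PrimeSieves, Lemma 9.5 and (9.1) (λ̃^{(c,η)} = ∏ M^{(c,η)})] -/
def lamVec (η c : ℝ) (m : ℕ) : VecFn := fun k x =>
  if (∀ i, η ≤ x i) ∧ ∑ i, x i = 1 then (m : ℝ) ^ k * ∏ i, modLiouville η c (x i) else 0

/-- The value on the support. [cite: FordMaynard2024PrimeSieves, Lemma 9.5] -/
theorem lamVec_eq_of {k : ℕ} {x : Fin k → ℝ} (h : (∀ i, η ≤ x i) ∧ ∑ i, x i = 1) :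
    lamVec η c m k x = (m : ℝ) ^ k * ∏ i, modLiouville η c (x i) := by
  simp only [lamVec, if_pos h]

/-- The value off the support. [cite: FordMaynard2024PrimeSieves, Lemma 9.5] -/
theorem lamVec_eq_zero_of_not {k : ℕ} {x : Fin k → ℝ} (h : ¬((∀ i, η ≤ x i) ∧ ∑ i, x i = 1)) :
    lamVec η c m k x = 0 := by
  simp only [lamVec, if_neg h]

/-- The value on the one-dimensional vector `(1)`: `m M^{(c,η)}(1)` (`η ≤ 1`).
[cite: FordMaynard2024PrimeSieves, §9.2] -/
theorem lamVec_one (h : η ≤ 1) : lamVec η c m 1 (fun _ => 1) = m * modLiouville η c 1 := by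
  rw [lamVec_eq_of ⟨fun _ => h, by simp⟩]
  simp

/-- A component of a vector with all components `≥ η ≥ 0` summing to `1` is `≤ 1`. [folklore] -/
theorem apply_le_one_of_supp (hη : 0 ≤ η) {k : ℕ} {x : Fin k → ℝ}
    (h : (∀ i, η ≤ x i) ∧ ∑ i, x i = 1) (i : Fin k) : x i ≤ 1 := by
  calc x i ≤ ∑ j, x j := Finset.single_le_sum (fun j _ => hη.trans (h.1 j)) (Finset.mem_univ i)
    _ = 1 := h.2

/-- The dimension of a vector in the support is `≤ 1/η`. [cite: FordMaynard2024PrimeSieves, §6 (remark after Definition 6.2)] -/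
theorem le_floor_of_supp (hη : 0 < η) {k : ℕ} {x : Fin k → ℝ}
    (h : (∀ i, η ≤ x i) ∧ ∑ i, x i = 1) : k ≤ ⌊1 / η⌋₊ := by
  refine Nat.le_floor ?_
  rw [le_div_iff₀ hη]
  calc (k : ℝ) * η = ∑ _i : Fin k, η := by simp
    _ ≤ ∑ i, x i := Finset.sum_le_sum fun i _ => h.1 i
    _ = 1 := h.2

/-- `M^{(c,η)}` is locally bounded and measurable. [folklore] -/
theorem locBdd_modLiouville (hη : 0 < η) (c : ℝ) : LocBdd (modLiouville η c) :=
  (locBdd_ellFn (locBdd_truncKernel hη c) (dkOrder η)).id_mul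

/-- `lamVec` is symmetric (class `𝒮`). [cite: FordMaynard2024PrimeSieves, Lemma 9.5 (proof)] -/
theorem lamVec_isSymmetric (η c : ℝ) (m : ℕ) : (lamVec η c m).IsSymmetric := by
  intro k σ x
  have hperm : ∏ i, modLiouville η c ((x ∘ σ) i) = ∏ i, modLiouville η c (x i) :=
    Equiv.prod_comp σ (fun i => modLiouville η c (x i))
  have hsum : ∑ i, (x ∘ σ) i = ∑ i, x i := Equiv.sum_comp σ x
  by_cases hx : (∀ i, η ≤ x i) ∧ ∑ i, x i = 1
  · have hx' : (∀ i, η ≤ (x ∘ σ) i) ∧ ∑ i, (x ∘ σ) i = 1 := ⟨fun i => hx.1 (σ i), hsum.trans hx.2⟩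
    rw [lamVec_eq_of hx', lamVec_eq_of hx, hperm]
  · have hx' : ¬((∀ i, η ≤ (x ∘ σ) i) ∧ ∑ i, (x ∘ σ) i = 1) := by
      rintro ⟨h1, h2⟩
      exact hx ⟨fun i => by simpa using h1 (σ.symm i), hsum.symm.trans h2⟩
    rw [lamVec_eq_zero_of_not hx', lamVec_eq_zero_of_not hx]

/-- `lamVec` is measurable in each dimension. [folklore] -/
theorem measurable_lamVec (hη : 0 < η) (c : ℝ) (m k : ℕ) : Measurable (lamVec η c m k) := by
  have hM : Measurable (modLiouville η c) := (locBdd_modLiouville hη c).measurable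
  have hset : MeasurableSet {x : Fin k → ℝ | (∀ i, η ≤ x i) ∧ ∑ i, x i = 1} := by
    have : {x : Fin k → ℝ | (∀ i, η ≤ x i) ∧ ∑ i, x i = 1} =
        (⋂ i, {x : Fin k → ℝ | η ≤ x i}) ∩ {x | ∑ i, x i = 1} := by
      ext x; simp
    rw [this]
    exact (MeasurableSet.iInter fun i => measurableSet_le measurable_const (measurable_pi_apply i)).inter
      (measurableSet_eq_fun (Finset.measurable_sum _ fun i _ => measurable_pi_apply i)
        measurable_const)
  unfold lamVec
  exact Measurable.ite hset (measurable_const.mul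
    (Finset.measurable_prod _ fun i _ => hM.comp (measurable_pi_apply i))) measurable_const

/-- `lamVec` is bounded (its support lives in dimensions `k ≤ 1/η` and in the cube `[η, 1]^k`).
[cite: FordMaynard2024PrimeSieves, Lemma 9.5 (proof)] -/
theorem lamVec_bounded (hη : 0 < η) (c : ℝ) (m : ℕ) : ∃ F : ℝ, ∀ (k : ℕ) (x : Fin k → ℝ),
    |lamVec η c m k x| ≤ F := by
  obtain ⟨B, hB0, hB⟩ := (locBdd_modLiouville hη c).bdd_nonneg 1
  set A : ℝ := max 1 ((m : ℝ) * B) with hA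
  refine ⟨A ^ ⌊1 / η⌋₊, fun k x => ?_⟩
  by_cases h : (∀ i, η ≤ x i) ∧ ∑ i, x i = 1
  · rw [lamVec_eq_of h]
    have hk : k ≤ ⌊1 / η⌋₊ := le_floor_of_supp hη h
    have hxi : ∀ i, |x i| ≤ 1 := fun i => by
      rw [abs_of_nonneg (hη.le.trans (h.1 i))]
      exact apply_le_one_of_supp hη.le h i
    calc |(m : ℝ) ^ k * ∏ i, modLiouville η c (x i)|
        = (m : ℝ) ^ k * ∏ i, |modLiouville η c (x i)| := by
          rw [abs_mul, abs_pow, Nat.abs_cast, Finset.abs_prod]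
      _ ≤ (m : ℝ) ^ k * ∏ _i : Fin k, B :=
          mul_le_mul_of_nonneg_left
            (Finset.prod_le_prod (fun i _ => abs_nonneg _) fun i _ => hB _ (hxi i)) (by positivity)
      _ = ((m : ℝ) * B) ^ k := by
          rw [Finset.prod_const, Finset.card_univ, Fintype.card_fin, mul_pow]
      _ ≤ A ^ k := pow_le_pow_left₀ (by positivity) (le_max_right _ _) k
      _ ≤ A ^ ⌊1 / η⌋₊ := pow_le_pow_right₀ (le_max_left _ _) hk
  · rw [lamVec_eq_zero_of_not h, abs_zero]
    positivity

/-! #### Piecewise Lipschitz: the `2^k` pieces indexed by the set of coordinates `< c` -/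

/-- Telescoping estimate for products: if `|a_i|, |b_i| ≤ B` (`B ≥ 1`) and `|a_i − b_i| ≤ δ` on `s`,
then `|∏_s a − ∏_s b| ≤ |s| B^{|s|} δ`. [folklore] -/
theorem abs_prod_sub_prod_le {ι : Type*} [DecidableEq ι] (s : Finset ι) {a b : ι → ℝ} {B δ : ℝ}
    (hB : 1 ≤ B) (hδ : 0 ≤ δ) (ha : ∀ i ∈ s, |a i| ≤ B) (hb : ∀ i ∈ s, |b i| ≤ B)
    (hab : ∀ i ∈ s, |a i - b i| ≤ δ) :
    |∏ i ∈ s, a i - ∏ i ∈ s, b i| ≤ s.card * B ^ s.card * δ := by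
  induction s using Finset.induction_on with
  | empty => simp
  | insert j s hj ih =>
    have ha' : ∀ i ∈ s, |a i| ≤ B := fun i hi => ha i (Finset.mem_insert_of_mem hi)
    have hb' : ∀ i ∈ s, |b i| ≤ B := fun i hi => hb i (Finset.mem_insert_of_mem hi)
    have hab' : ∀ i ∈ s, |a i - b i| ≤ δ := fun i hi => hab i (Finset.mem_insert_of_mem hi)
    have hih := ih ha' hb' hab'
    have hB0 : 0 ≤ B := zero_le_one.trans hB
    rw [Finset.prod_insert hj, Finset.prod_insert hj, Finset.card_insert_of_notMem hj]
    have hPb : |∏ i ∈ s, b i| ≤ B ^ s.card := by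
      rw [Finset.abs_prod]
      calc ∏ i ∈ s, |b i| ≤ ∏ _i ∈ s, B := Finset.prod_le_prod (fun i _ => abs_nonneg _) hb'
        _ = B ^ s.card := Finset.prod_const B
    have hdecomp : a j * ∏ i ∈ s, a i - b j * ∏ i ∈ s, b i =
        a j * (∏ i ∈ s, a i - ∏ i ∈ s, b i) + (a j - b j) * ∏ i ∈ s, b i := by ring
    rw [hdecomp]
    have hpow : B ^ s.card ≤ B ^ s.card * B := le_mul_of_one_le_right (pow_nonneg hB0 _) hB
    calc |a j * (∏ i ∈ s, a i - ∏ i ∈ s, b i) + (a j - b j) * ∏ i ∈ s, b i|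
        ≤ |a j| * |∏ i ∈ s, a i - ∏ i ∈ s, b i| + |a j - b j| * |∏ i ∈ s, b i| := by
          rw [← abs_mul, ← abs_mul]; exact abs_add_le _ _
      _ ≤ B * (s.card * B ^ s.card * δ) + δ * B ^ s.card :=
          add_le_add (mul_le_mul (ha j (Finset.mem_insert_self j s)) hih (abs_nonneg _) hB0)
            (mul_le_mul (hab j (Finset.mem_insert_self j s)) hPb (abs_nonneg _) hδ)
      _ ≤ ((s.card + 1 : ℕ) : ℝ) * B ^ (s.card + 1) * δ := by
          have h1 : δ * B ^ s.card ≤ δ * (B ^ s.card * B) := mul_le_mul_of_nonneg_left hpow hδ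
          push_cast
          rw [pow_succ]
          nlinarith [h1]

/-- The piece of the support of `lamVec` on which exactly the coordinates in `S` are `< c`.
[cite: FordMaynard2024PrimeSieves, Lemma 9.5 (proof: "M is piecewise differentiable, so is f")] -/
def lamPiece (η c : ℝ) (k : ℕ) (S : Finset (Fin k)) : Set (Fin k → ℝ) :=
  {x | ((∀ i, η ≤ x i) ∧ ∑ i, x i = 1) ∧ (∀ i, i ∈ S → x i < c) ∧ ∀ i, i ∉ S → c ≤ x i}

/-- The pieces lie in the closed unit ball (`η > 0`). [folklore] -/
theorem lamPiece_subset_closedBall (hη : 0 < η) (c : ℝ) (k : ℕ) (S : Finset (Fin k)) :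
    lamPiece η c k S ⊆ Metric.closedBall 0 1 := by
  intro x hx
  rw [Metric.mem_closedBall, dist_pi_le_iff zero_le_one]
  intro i
  rw [Pi.zero_apply, Real.dist_0_eq_abs, abs_of_nonneg (hη.le.trans (hx.1.1 i))]
  exact apply_le_one_of_supp hη.le hx.1 i

/-- Sum of a coordinate vector against a vector: `∑_l [l = i] a x_l = a x_i`. [folklore] -/
theorem sum_ite_eq_mul {k : ℕ} (i : Fin k) (a : ℝ) (x : Fin k → ℝ) :
    ∑ l, (if l = i then a else 0) * x l = a * x i := by
  simp [ite_mul]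

/-- The pieces are convex polytopes (Definition 5.7). [cite: FordMaynard2024PrimeSieves, Definition 5.7] -/
theorem isConvexPolytope_lamPiece (hη : 0 < η) (c : ℝ) (k : ℕ) (S : Finset (Fin k)) :
    IsConvexPolytope (lamPiece η c k S) := by
  classical
  refine isConvexPolytope_of_constraints (ι₁ := ↥S) (ι₂ := (Fin k ⊕ {i : Fin k // i ∉ S}) ⊕ Bool)
    (fun j l => if l = (j : Fin k) then (1 : ℝ) else 0) (fun _ => c)
    (Sum.elim (Sum.elim (fun i l => if l = i then (-1 : ℝ) else 0)
      (fun i l => if l = (i : Fin k) then (-1 : ℝ) else 0))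
      (fun b _ => if b then (1 : ℝ) else -1))
    (Sum.elim (Sum.elim (fun _ => -η) (fun _ => -c)) (fun b => if b then (1 : ℝ) else -1))
    ((Metric.isBounded_closedBall).subset (lamPiece_subset_closedBall hη c k S)) fun x => ?_
  simp only [lamPiece, Set.mem_setOf_eq, Sum.forall, Sum.elim_inl, Sum.elim_inr, Subtype.forall,
    Bool.forall_bool, Bool.false_eq_true, if_true, if_false, sum_ite_eq_mul, one_mul, neg_mul,
    neg_le_neg_iff, Finset.sum_neg_distrib]
  constructor
  · rintro ⟨⟨hge, hsum⟩, hlt, hcle⟩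
    exact ⟨hlt, ⟨hge, hcle⟩, by rw [hsum], by rw [hsum]⟩
  · rintro ⟨hlt, ⟨hge, hcle⟩, h1, h2⟩
    exact ⟨⟨hge, le_antisymm h2 (by linarith)⟩, hlt, hcle⟩

/-- `lamVec` is the sum of its restrictions to the pieces. [cite: FordMaynard2024PrimeSieves, Lemma 9.5 (proof)] -/
theorem lamVec_eq_sum_pieces (η c : ℝ) (m k : ℕ) (x : Fin k → ℝ) :
    lamVec η c m k x = ∑ S : Finset (Fin k), (lamPiece η c k S).indicator (lamVec η c m k) x := by
  classical
  by_cases h : (∀ i, η ≤ x i) ∧ ∑ i, x i = 1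
  · set S₀ : Finset (Fin k) := Finset.univ.filter fun i => x i < c with hS₀
    have hx₀ : x ∈ lamPiece η c k S₀ := by
      refine ⟨h, fun i hi => (Finset.mem_filter.1 hi).2, fun i hi => ?_⟩
      by_contra hlt
      exact hi (Finset.mem_filter.2 ⟨Finset.mem_univ _, not_le.1 hlt⟩)
    rw [Finset.sum_eq_single S₀ (fun S _ hS => ?_) (fun hS => absurd (Finset.mem_univ _) hS),
      Set.indicator_of_mem hx₀]
    refine Set.indicator_of_notMem (fun hxS => hS ?_) _
    ext i
    constructor
    · intro hi
      exact Finset.mem_filter.2 ⟨Finset.mem_univ _, hxS.2.1 i hi⟩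
    · intro hi
      by_contra hiS
      exact absurd (hxS.2.2 i hiS) (not_le.2 (Finset.mem_filter.1 hi).2)
  · rw [lamVec_eq_zero_of_not h]
    refine (Finset.sum_eq_zero fun S _ => ?_).symm
    exact Set.indicator_of_notMem (fun hxS => h hxS.1) _

/-- On each piece `lamVec` is Lipschitz (`M^{(c,η)} = −1` on the coordinates `< c`, Lipschitz on
`[c, 1]` on the others). [cite: FordMaynard2024PrimeSieves, Lemma 9.5 (proof)] -/
theorem lipschitzOn_lamVec_piece (hη : 0 < η) (hc : 3 * η ≤ c) (hc1 : c ≤ 1) (m k : ℕ)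
    (S : Finset (Fin k)) :
    ∃ K, LipschitzOnWith K ((lamPiece η c k S).indicator (lamVec η c m k)) (lamPiece η c k S) := by
  classical
  obtain ⟨L, hL0, hL⟩ := exists_lipschitz_modLiouville hη hc hc1
  obtain ⟨B, hB0, hB⟩ := (locBdd_modLiouville hη c).bdd_nonneg 1
  set B₁ : ℝ := max 1 B with hB₁
  refine ⟨Real.toNNReal ((m : ℝ) ^ k * (k * B₁ ^ k * L)),
    LipschitzOnWith.of_dist_le' fun x hx y hy => ?_⟩
  rw [Set.indicator_of_mem hx, Set.indicator_of_mem hy, lamVec_eq_of hx.1, lamVec_eq_of hy.1,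
    Real.dist_eq, ← mul_sub, abs_mul, abs_pow, Nat.abs_cast]
  have hxi : ∀ i, |x i| ≤ 1 := fun i => by
    rw [abs_of_nonneg (hη.le.trans (hx.1.1 i))]; exact apply_le_one_of_supp hη.le hx.1 i
  have hyi : ∀ i, |y i| ≤ 1 := fun i => by
    rw [abs_of_nonneg (hη.le.trans (hy.1.1 i))]; exact apply_le_one_of_supp hη.le hy.1 i
  have key := abs_prod_sub_prod_le Finset.univ (a := fun i => modLiouville η c (x i))
    (b := fun i => modLiouville η c (y i)) (B := B₁) (δ := L * dist x y) (le_max_left _ _)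
    (by positivity) (fun i _ => (hB _ (hxi i)).trans (le_max_right _ _))
    (fun i _ => (hB _ (hyi i)).trans (le_max_right _ _)) ?_
  · rw [Finset.card_univ, Fintype.card_fin] at key
    calc (m : ℝ) ^ k * |∏ i, modLiouville η c (x i) - ∏ i, modLiouville η c (y i)|
        ≤ (m : ℝ) ^ k * (k * B₁ ^ k * (L * dist x y)) :=
          mul_le_mul_of_nonneg_left key (by positivity)
      _ = (m : ℝ) ^ k * (k * B₁ ^ k * L) * dist x y := by ring
  · intro i _
    by_cases hi : i ∈ S
    · rw [modLiouville_eq_neg_one hη (by linarith) (hx.1.1 i) (hx.2.1 i hi),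
        modLiouville_eq_neg_one hη (by linarith) (hy.1.1 i) (hy.2.1 i hi), sub_self, abs_zero]
      positivity
    · calc |modLiouville η c (x i) - modLiouville η c (y i)| ≤ L * |x i - y i| :=
            hL (x i) ⟨hx.2.2 i hi, apply_le_one_of_supp hη.le hx.1 i⟩ (y i)
              ⟨hy.2.2 i hi, apply_le_one_of_supp hη.le hy.1 i⟩
        _ ≤ L * dist x y := by
            refine mul_le_mul_of_nonneg_left ?_ hL0
            rw [← Real.dist_eq]
            exact dist_le_pi_dist x y i

/-- `lamVec` satisfies Definition 6.2 (b) in every dimension (`0 < η`, `3η ≤ c ≤ 1`).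
[cite: FordMaynard2024PrimeSieves, Lemma 9.5 (proof)] -/
theorem isPiecewiseLipschitz_lamVec (hη : 0 < η) (hc : 3 * η ≤ c) (hc1 : c ≤ 1) (m k : ℕ) :
    IsPiecewiseLipschitz (lamVec η c m k) := by
  classical
  exact IsPiecewiseLipschitz.of_fintype (ι := Finset (Fin k)) (lamPiece η c k)
    (fun S => (lamPiece η c k S).indicator (lamVec η c m k))
    (fun S => isConvexPolytope_lamPiece hη c k S) (fun S x hx => Set.indicator_of_notMem hx _)
    (fun S => lipschitzOn_lamVec_piece hη hc hc1 m k S) (lamVec_eq_sum_pieces η c m k)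

/-! #### The Type-I identity (TypeI-f): Lemma 9.5 via Lemma 9.2 -/

/-- The value of `lamVec` at a concatenation `(ξ, v)` on the slice `|v| = 1 − |ξ|` when all
`ξ_j ≥ η`: `m^{r+d} ∏ M(ξ_j) ∏ M(v_i)` (both sides vanish if some `v_i < η`).
[cite: FordMaynard2024PrimeSieves, Lemma 9.5 (proof), (9.1) ("completely multiplicative")] -/
theorem lamVec_append (hη : 0 < η) {r d : ℕ} {ξ : Fin r → ℝ} (hξ : ∀ j, η ≤ ξ j)
    {v : Fin d → ℝ} (hv : ∑ i, v i = 1 - ∑ j, ξ j) :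
    lamVec η c m (r + d) (Fin.append ξ v) =
      (m : ℝ) ^ (r + d) * ((∏ j, modLiouville η c (ξ j)) * ∏ i, modLiouville η c (v i)) := by
  have hsum : ∑ i, Fin.append ξ v i = 1 := by
    rw [Fin.sum_univ_add]
    simp only [Fin.append_left, Fin.append_right, hv]
    ring
  have hprod : ∏ i, modLiouville η c (Fin.append ξ v i) =
      (∏ j, modLiouville η c (ξ j)) * ∏ i, modLiouville η c (v i) := by
    rw [Fin.prod_univ_add]
    simp only [Fin.append_left, Fin.append_right]
  by_cases hvη : ∀ i, η ≤ v i
  · have hall : ∀ i, η ≤ Fin.append ξ v i := fun i => by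
      induction i using Fin.addCases with
      | left j => simpa using hξ j
      | right j => simpa using hvη j
    rw [lamVec_eq_of ⟨hall, hsum⟩, hprod]
  · push Not at hvη
    obtain ⟨i, hi⟩ := hvη
    rw [lamVec_eq_zero_of_not, Finset.prod_eq_zero (Finset.mem_univ i) (modLiouville_of_lt hη hi)]
    · simp
    · rintro ⟨hge, -⟩
      exact absurd (hge (Fin.natAdd r i)) (by simpa using hi)

/-- **Lemma 9.5 (Type-I part)**: `lamVec η c m` satisfies (TypeI-f) with parameter `γ` when
`0 < η`, `0 ≤ c`, `γ < 1` and `m c ≤ 1 − γ` — by the model Lemma 9.2 (`sum_cpow_ellFn_eq_zero`):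
for fixed `ξ` with `|ξ| ≤ γ`, `∑_d typeITerm d = m^r λ̃(ξ) ∑_d (m^d/d!) ℓ^{⋆d}(1 − |ξ|) = 0` as soon
as the truncation point is `≥ dkOrder η`. [cite: FordMaynard2024PrimeSieves, Lemma 9.5 (proof) and Lemma 9.2] -/
theorem typeIIdentity_lamVec (hη : 0 < η) (hc0 : 0 ≤ c) (hγ : γ < 1) (hmc : (m : ℝ) * c ≤ 1 - γ) :
    TypeIIdentity γ (lamVec η c m) := by
  intro r ξ hξ
  refine ⟨dkOrder η, fun N hN => ?_⟩
  have hw0 : 0 < 1 - ∑ j, ξ j := by linarith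
  by_cases hξη : ∀ j, η ≤ ξ j
  · -- the main case: all `ξ_j ≥ η`
    have hℓ : LocBdd (ellFn (truncKernel η c) (dkOrder η)) :=
      locBdd_ellFn (locBdd_truncKernel hη c) _
    have hφ : LocBdd (fun t => (m : ℝ) * ellFn (truncKernel η c) (dkOrder η) t) := hℓ.const_mul _
    have hterm : ∀ d, 1 ≤ d → typeITerm (lamVec η c m) r ξ d =
        ((m : ℝ) ^ r * ∏ j, modLiouville η c (ξ j)) *
          ((m : ℝ) ^ d / d.factorial * cpow (ellFn (truncKernel η c) (dkOrder η)) d (1 - ∑ j, ξ j)) := by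
      intro d hd
      obtain ⟨d, rfl⟩ : ∃ d', d = d' + 1 := ⟨d - 1, by omega⟩
      unfold typeITerm
      rw [sliceIntegral_congr (G' := fun u => ((m : ℝ) ^ r * ∏ j, modLiouville η c (ξ j)) *
          ∏ i, (m : ℝ) * ellFn (truncKernel η c) (dkOrder η) (u i)) ?_,
        sliceIntegral_const_mul_prod hφ _ d hw0, cpow_const_mul]
      · simp only []
        ring
      · intro v hv hsum
        have hvpos : 0 < ∏ i, v i := Finset.prod_pos fun i _ => hv i
        have hMv : ∏ i, modLiouville η c (v i) =
            (∏ i, v i) * ∏ i, ellFn (truncKernel η c) (dkOrder η) (v i) := by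
          rw [← Finset.prod_mul_distrib]
          rfl
        show lamVec η c m (r + (d + 1)) (Fin.append ξ v) / ∏ i, v i = _
        rw [lamVec_append hη hξη hsum, hMv, Finset.prod_mul_distrib, Finset.prod_const,
          Finset.card_univ, Fintype.card_fin, pow_add]
        field_simp
    rw [Finset.sum_congr rfl fun d hd => hterm d (Finset.mem_Icc.1 hd).1, ← Finset.mul_sum]
    have h1 : (1 : ℝ) < ((dkOrder η : ℕ) + 1) * η := by
      have := dkOrder_mul_gt hη
      rw [add_mul, one_mul]
      linarith
    have hw1 : 1 - ∑ j, ξ j ∈ Set.Icc (0 : ℝ) 1 :=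
      ⟨hw0.le, by linarith [Finset.sum_nonneg fun j (_ : j ∈ Finset.univ) => hη.le.trans (hξη j)]⟩
    have hmw : (m : ℝ) * c ≤ 1 - ∑ j, ξ j := by linarith
    rw [sum_cpow_ellFn_eq_zero (locBdd_truncKernel hη c) (fun t ht => truncKernel_of_lt_eta hη ht)
      hc0 (fun t ht => truncKernel_of_le ht) hN h1 m hw1 hmw, mul_zero]
  · -- degenerate case: some `ξ_j < η`, every term vanishes
    push Not at hξη
    obtain ⟨j, hj⟩ := hξη
    refine Finset.sum_eq_zero fun d _ => ?_
    unfold typeITerm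
    rw [sliceIntegral_congr (G' := fun _ => 0) ?_, sliceIntegral_zero, mul_zero]
    intro v _ _
    rw [lamVec_eq_zero_of_not, zero_div]
    rintro ⟨hge, -⟩
    exact absurd (hge (Fin.castAdd d j)) (by simpa using hj)

/-- **Ford–Maynard, Lemma 9.5.** For `0 < η`, `3η ≤ c ≤ 1`, `γ < 1` and `m c ≤ 1 − γ`, the function
`f(x) = m^k λ̃^{(c,η)}(x)` (on vectors with components `≥ η` summing to `1`) belongs to
`𝔉*_η(γ)`. [cite: FordMaynard2024PrimeSieves, Lemma 9.5] -/
theorem memTypeIStar_lamVec (hη : 0 < η) (hc : 3 * η ≤ c) (hc1 : c ≤ 1) (hγ : γ < 1)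
    (hmc : (m : ℝ) * c ≤ 1 - γ) : MemTypeIStar η γ (lamVec η c m) where
  symm := lamVec_isSymmetric η c m
  support k x h := by
    by_contra hne
    exact h (lamVec_eq_zero_of_not hne)
  bounded := lamVec_bounded hη c m
  piecewiseLipschitz k := isPiecewiseLipschitz_lamVec hη hc hc1 m k
  typeI := typeIIdentity_lamVec hη (by linarith) hγ hmc

end Lambda

end Literature.NumberTheory.Sieve.FordMaynard
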